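import Summits.KontsevichZagierPeriods.KontsevichZagierPeriods.Theses.TorsionLogs
import Summits.KontsevichZagierPeriods.KontsevichZagierPeriods.Theorems.HyperbolicBlochOffTetraSectorKernelStubHermiteLindemannRing
import Summits.KontsevichZagierPeriods.KontsevichZagierPeriods.Theorems.TorsionLogsNeronTorsionSectorAssemblyMain
import Literature.NumberTheory.Transcendental.SemialgebraicAlgebraicPoints
/-!
# Crux `TorsionLogs.NeronTorsionSector` (stmt-KontsevichZagierPeriods-14500) — line `registered`, CLOSED

The crux `NeronTorsionSector` of the route `TorsionLogs` (periods of a tied Néron–torsion element of a real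
elliptic curve with rational torsion are chains of Kontsevich–Zagier moves): proved by the TRANSLATION-ONLY chain
of the lead's reshaped skeleton (`Cruxes/NeronTorsionSector/Lines/birth.lean`, v6): the primitive chain
`q²•[rI] + p²•[rP] − c•[1 < t < B, dt/t] ∈ KZ.relations` is the landed `stub_assembly` (assembled from thirty landed
blocks: the real Weierstrass dictionary, the torsion grid, Haar representations, the translation calculus and the dlog
potential of the cocycle, the generic translation step and its instances, the corner chart at infinity, the regular and
hard logs, the quotient bookkeeping and the period symmetry), and the bookkeeping below (carried over from the
registrar skeleton, kernel-checked) turns the primitive chain into the crux: the tie `(M, k) = s(q², p²)` by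
coprimality, soundness of the calculus for the value, and Hermite–Lindemann for the log of an algebraic number.
[cite: KontsevichZagier2001, §1.2] [cite: Lang1983, Ch. 13 Thm 1.1] [cite: Lawden1989, §6.8, §6.11–6.12]
-/

noncomputable section

open Set MeasureTheory Filter Topology
open Literature.NumberTheory.Transcendental Literature.ModelTheory.ExponentialFields
open Summit.KontsevichZagierPeriods.KontsevichZagierPeriods.Theses.TorsionLogs (NeronTorsionSector)
open Summit.KontsevichZagierPeriods.HyperbolicBloch.OffTetraSectorKernel (exists_logRep
  interval_log_relation_mem_relations hermiteLindemann_evalP_log)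

-- `Summit.KontsevichZagierPeriods.KontsevichZagierPeriods.…` is the tree's mandated layout (single-conjunct summit).
set_option linter.dupNamespace false

namespace Summit.KontsevichZagierPeriods.KontsevichZagierPeriods.Cruxes.NeronTorsionSector.Translation

/-! ### Bookkeeping: from the primitive chain to the crux -/

/-- The log carrier `[1 < t < B, dt/t]` has value `log B` (`1 ≤ B`). [cite: KontsevichZagier2001, §1.1] -/
theorem logRep_value {B : ℝ} (hB : 1 ≤ B) (R : Literature.NumberTheory.Transcendental.KZ.IntegralRep 1)
    (hd : R.domain = {t | 1 < t 0 ∧ t 0 < B})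
    (hi : Set.EqOn R.integrand (fun t => (t 0)⁻¹) R.domain) : R.value = Real.log B := by
  have h := hermiteLindemann_evalP_log hB R hd (fun t ht => by simp only [hi ht, one_div])
  rwa [KZ.evalP_toFormalPeriod_of] at h

/-- The right end point `B > 1` of the `ℚ`-semialgebraic domain `(1, B)` of a log carrier is algebraic:
at `(B)` the domain is neither a neighbourhood nor a co-neighbourhood. [folklore] -/
theorem isAlgebraic_of_logRep {B : ℝ} (hB : 1 < B) (R : Literature.NumberTheory.Transcendental.KZ.IntegralRep 1)
    (hd : R.domain = {t | 1 < t 0 ∧ t 0 < B}) : IsAlgebraic ℚ B := by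
  set x : Fin 1 → ℝ := fun _ => B with hx
  have h := isAlgebraic_of_not_mem_nhds (x := x) R.isSemialgebraic_domain ?_ ?_
  · simpa [hx] using h
  · intro h
    have hmem : x ∈ R.domain := mem_of_mem_nhds h
    rw [hd] at hmem
    exact lt_irrefl B (by simpa [hx] using hmem.2)
  · intro h
    obtain ⟨ε, hε, hball⟩ := Metric.mem_nhds_iff.mp h
    set δ : ℝ := min (ε / 2) ((B - 1) / 2) with hδ
    have hδpos : 0 < δ := lt_min (by linarith) (by linarith)
    have hδε : δ < ε := (min_le_left _ _).trans_lt (by linarith)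
    have hδB : δ < B - 1 := (min_le_right _ _).trans_lt (by linarith)
    set z : Fin 1 → ℝ := fun _ => B - δ with hz
    have hzball : z ∈ Metric.ball x ε := by
      rw [Metric.mem_ball, dist_pi_lt_iff hε]
      intro b
      rw [hz, hx, Real.dist_eq, show B - δ - B = -δ by ring, abs_neg, abs_of_pos hδpos]
      exact hδε
    have hzR : z ∈ R.domain := by
      rw [hd]
      change 1 < B - δ ∧ B - δ < B
      constructor <;> linarith
    exact hball hzball hzR

/-- **The crux from the primitive chain** (real proof, carried over from the registrar skeleton's
`NeronTorsionSector_of_stubs` with the saturation detour removed): for a tied instance `(M, k, m, α)`,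
`ρ = p/q` in lowest terms (`Nat.coprime_div_gcd_div_gcd`); the tie `4N²k = M(N−2a)²` and `q(N−2a) = 2Np`
give `q²k = p²M`, so `(M, k) = s·(q², p²)` (`IsCoprime.dvd_of_dvd_mul_left`); soundness
(`KZ.relations_le_ker_eval_holds`) of the primitive chain and the value hypothesis give
`s c log B = m log α` between logarithms of real algebraic numbers (`α` algebraic because `(1, α)` is
`ℚ`-semialgebraic), realised by moves by the landed log calculus (`interval_log_relation_mem_relations`);
`M[rI] + k[rP] − m[rL] = s•(q²[rI] + p²[rP] − c[rB]) + ((sc)[rB] − m[rL])`.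
[cite: KontsevichZagier2001, §1.2] [cite: Lang1983, Ch. 13 Thm 1.1] -/
theorem NeronTorsionSector_of_primitiveChain
    (hPC : ∀ (g₂ g₃ e₁ xP yP : ℝ) (N a p q : ℕ) (f : ℝ → ℝ),
      (∀ x, f x = 4 * x ^ 3 - g₂ * x - g₃) → g₂ ^ 3 - 27 * g₃ ^ 2 ≠ 0 → f e₁ = 0 → 0 < e₁ →
      (∀ x, e₁ < x → 0 < f x) → e₁ < xP → yP ^ 2 = f xP → 3 ≤ N → 0 < a → 2 * a < N →
      (∀ hns : (⟨0, 0, 0, -g₂ / 4, -g₃ / 4⟩ : WeierstrassCurve ℝ).toAffine.Nonsingular xP (yP / 2),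
      addOrderOf (WeierstrassCurve.Affine.Point.some xP (yP / 2) hns) = N) →
      (N : ℝ) * (∫ x in Set.Ioi xP, (Real.sqrt (f x))⁻¹) = a * (2 * ∫ x in Set.Ioi e₁, (Real.sqrt (f x))⁻¹) →
      Nat.Coprime p q → (q : ℤ) * ((N : ℤ) - 2 * (a : ℤ)) = (p : ℤ) * (2 * (N : ℤ)) →
      ∀ (rI rP : Literature.NumberTheory.Transcendental.KZ.IntegralRep 2),
      rI.domain = {z | e₁ < z 1 ∧ z 1 < z 0 ∧ z 0 < xP} →
      Set.EqOn rI.integrand (fun z => z 1 / (Real.sqrt (f (z 1)) * Real.sqrt (f (z 0)))) rI.domain →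
      rP.domain = {z | e₁ < z 0 ∧ e₁ < z 1} →
      Set.EqOn rP.integrand
      (fun z => (Real.sqrt (f (z 0)))⁻¹ * ((g₂ * z 1 + 2 * g₃) / (2 * (z 1) ^ 2 * Real.sqrt (f (z 1))))) rP.domain →
      ∃ (c : ℤ) (B : ℝ) (rB : Literature.NumberTheory.Transcendental.KZ.IntegralRep 1), 1 < B ∧ IsAlgebraic ℚ B ∧
      rB.domain = {t | 1 < t 0 ∧ t 0 < B} ∧ Set.EqOn rB.integrand (fun t => (t 0)⁻¹) rB.domain ∧
      ((q : ℤ) ^ 2) • Literature.NumberTheory.Transcendental.KZ.of rI + ((p : ℤ) ^ 2) • Literature.NumberTheory.Transcendental.KZ.of rP - c • Literature.NumberTheory.Transcendental.KZ.of rB ∈ Literature.NumberTheory.Transcendental.KZ.relations) :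
    ∀ (g₂ g₃ e₁ xP yP α : ℝ) (N a : ℕ) (M k m : ℤ) (f : ℝ → ℝ), (∀ x, f x = 4 * x ^ 3 - g₂ * x - g₃) → g₂ ^ 3 - 27 * g₃ ^ 2 ≠ 0 → f e₁ = 0 → 0 < e₁ → (∀ x, e₁ < x → 0 < f x) → e₁ < xP → yP ^ 2 = f xP → 3 ≤ N → 0 < a → 2 * a < N → 4 * (N : ℤ) ^ 2 * k = M * ((N : ℤ) - 2 * (a : ℤ)) ^ 2 → (∀ hns : (⟨0, 0, 0, -g₂ / 4, -g₃ / 4⟩ : WeierstrassCurve ℝ).toAffine.Nonsingular xP (yP / 2), addOrderOf (WeierstrassCurve.Affine.Point.some xP (yP / 2) hns) = N) → (N : ℝ) * (∫ x in Set.Ioi xP, (Real.sqrt (f x))⁻¹) = a * (2 * ∫ x in Set.Ioi e₁, (Real.sqrt (f x))⁻¹) → 1 < α → ∀ (rI rP : Literature.NumberTheory.Transcendental.KZ.IntegralRep 2) (rL : Literature.NumberTheory.Transcendental.KZ.IntegralRep 1), rI.domain = {z | e₁ < z 1 ∧ z 1 < z 0 ∧ z 0 < xP} → Set.EqOn rI.integrand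 (fun z => z 1 / (Real.sqrt (f (z 1)) * Real.sqrt (f (z 0)))) rI.domain → rP.domain = {z | e₁ < z 0 ∧ e₁ < z 1} → Set.EqOn rP.integrand (fun z => (Real.sqrt (f (z 0)))⁻¹ * ((g₂ * z 1 + 2 * g₃) / (2 * (z 1) ^ 2 * Real.sqrt (f (z 1))))) rP.domain → rL.domain = {t | 1 < t 0 ∧ t 0 < α} → Set.EqOn rL.integrand (fun t => (t 0)⁻¹) rL.domain → (M : ℝ) * rI.value + k * rP.value = m * rL.value → M • Literature.NumberTheory.Transcendental.KZ.of rI + k • Literature.NumberTheory.Transcendental.KZ.of rP - m • Literature.NumberTheory.Transcendental.KZ.of rL ∈ Literature.NumberTheory.Transcendental.KZ.relations := by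
  intro g₂ g₃ e₁ xP yP α N a M k m f hf hdisc he he0 hpos hx hy hN ha ha2 htie htor hρ hα rI rP rL hdI hiI
    hdP hiP hdL hiL hval
  -- reduced exponents `ρ = (N − 2a)/(2N) = p/q`
  have h2a : 2 * a ≤ N := by omega
  obtain ⟨p, q, hcop, hpqN, hq0⟩ :
      ∃ p q : ℕ, Nat.Coprime p q ∧ q * (N - 2 * a) = p * (2 * N) ∧ 0 < q := by
    have hg0 : 0 < Nat.gcd (N - 2 * a) (2 * N) := Nat.gcd_pos_of_pos_right _ (by omega)
    refine ⟨(N - 2 * a) / Nat.gcd (N - 2 * a) (2 * N), (2 * N) / Nat.gcd (N - 2 * a) (2 * N),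
      Nat.coprime_div_gcd_div_gcd hg0, ?_, ?_⟩
    · have hp' : (N - 2 * a) / Nat.gcd (N - 2 * a) (2 * N) * Nat.gcd (N - 2 * a) (2 * N) = N - 2 * a :=
        Nat.div_mul_cancel (Nat.gcd_dvd_left _ _)
      have hq' : (2 * N) / Nat.gcd (N - 2 * a) (2 * N) * Nat.gcd (N - 2 * a) (2 * N) = 2 * N :=
        Nat.div_mul_cancel (Nat.gcd_dvd_right _ _)
      calc (2 * N) / Nat.gcd (N - 2 * a) (2 * N) * (N - 2 * a)
          = (2 * N) / Nat.gcd (N - 2 * a) (2 * N) *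
              ((N - 2 * a) / Nat.gcd (N - 2 * a) (2 * N) * Nat.gcd (N - 2 * a) (2 * N)) := by rw [hp']
        _ = (N - 2 * a) / Nat.gcd (N - 2 * a) (2 * N) *
              ((2 * N) / Nat.gcd (N - 2 * a) (2 * N) * Nat.gcd (N - 2 * a) (2 * N)) := by ring
        _ = (N - 2 * a) / Nat.gcd (N - 2 * a) (2 * N) * (2 * N) := by rw [hq']
    · exact Nat.div_pos (Nat.le_of_dvd (by omega) (Nat.gcd_dvd_right _ _)) hg0
  have hpqZ : (q : ℤ) * ((N : ℤ) - 2 * (a : ℤ)) = (p : ℤ) * (2 * (N : ℤ)) := by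
    have h := congrArg (Nat.cast : ℕ → ℤ) hpqN
    push_cast [Nat.cast_sub h2a] at h
    linarith
  -- the tie: `(M, k) = s • (q², p²)`
  have hN0 : (N : ℤ) ≠ 0 := by exact_mod_cast (show N ≠ 0 by omega)
  have hqk : (q : ℤ) ^ 2 * k = (p : ℤ) ^ 2 * M := by
    have h4 : (4 : ℤ) * (N : ℤ) ^ 2 ≠ 0 := mul_ne_zero (by norm_num) (pow_ne_zero 2 hN0)
    apply mul_left_cancel₀ h4
    calc 4 * (N : ℤ) ^ 2 * ((q : ℤ) ^ 2 * k) = (q : ℤ) ^ 2 * (4 * (N : ℤ) ^ 2 * k) := by ring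
      _ = (q : ℤ) ^ 2 * (M * ((N : ℤ) - 2 * (a : ℤ)) ^ 2) := by rw [htie]
      _ = M * ((q : ℤ) * ((N : ℤ) - 2 * (a : ℤ))) ^ 2 := by ring
      _ = M * ((p : ℤ) * (2 * (N : ℤ))) ^ 2 := by rw [hpqZ]
      _ = 4 * (N : ℤ) ^ 2 * ((p : ℤ) ^ 2 * M) := by ring
  have hcopZ : IsCoprime ((q : ℤ) ^ 2) ((p : ℤ) ^ 2) := by
    have h := Nat.isCoprime_iff_coprime.mpr (hcop.symm.pow 2 2)
    push_cast at h
    exact h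
  obtain ⟨s, hs⟩ : (q : ℤ) ^ 2 ∣ M :=
    hcopZ.dvd_of_dvd_mul_left ⟨k, by linear_combination -hqk⟩
  have hq0Z : (q : ℤ) ^ 2 ≠ 0 := pow_ne_zero 2 (by exact_mod_cast hq0.ne')
  have hk : k = (p : ℤ) ^ 2 * s := by
    apply mul_left_cancel₀ hq0Z
    rw [hqk, hs]
    ring
  -- the primitive chain and its value
  obtain ⟨c, B, rB, hB, hBalg, hdB, hiB, hprim⟩ :=
    hPC g₂ g₃ e₁ xP yP N a p q f hf hdisc he he0 hpos hx hy hN ha ha2 htor hρ hcop hpqZ rI rP hdI hiI hdP hiP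
  have hvB : rB.value = Real.log B := logRep_value hB.le rB hdB hiB
  have hvL : rL.value = Real.log α := logRep_value hα.le rL hdL hiL
  have hαalg : IsAlgebraic ℚ α := isAlgebraic_of_logRep hα rL hdL
  have h0 : (q : ℝ) ^ 2 * rI.value + (p : ℝ) ^ 2 * rP.value - c * Real.log B = 0 := by
    have h := KZ.relations_le_ker_eval_holds hprim
    rw [AddMonoidHom.mem_ker] at h
    simpa only [map_add, map_sub, map_zsmul, KZ.eval_of, zsmul_eq_mul, Int.cast_pow, Int.cast_natCast,
      hvB] using h
  -- the value hypothesis becomes a relation between two logarithms of algebraic numbers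
  have hlog : (s : ℝ) * c * Real.log B - m * Real.log α = 0 := by
    have hM : (M : ℝ) = (q : ℝ) ^ 2 * s := by
      rw [hs]
      push_cast
      ring
    have hK : (k : ℝ) = (p : ℝ) ^ 2 * s := by
      rw [hk]
      push_cast
      ring
    rw [hM, hK, hvL] at hval
    linear_combination hval - (s : ℝ) * h0
  -- landed log calculus: `(s c)•[rB] − m•[rL] ∈ relations`
  have hiB1 : Set.EqOn rB.integrand (fun t : Fin 1 → ℝ => 1 / t 0) rB.domain := fun t ht => by
    simp only [hiB ht, one_div]
  have hiL1 : Set.EqOn rL.integrand (fun t : Fin 1 → ℝ => 1 / t 0) rL.domain := fun t ht => by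
    simp only [hiL ht, one_div]
  have hL : (s * c) • KZ.of rB - m • KZ.of rL ∈ KZ.relations := by
    have h := interval_log_relation_mem_relations 2 ![1, 1] ![B, α] ![s * c, -m] ![rB, rL]
      (fun i => by fin_cases i <;> simp)
      (fun i => by fin_cases i <;> simp [hB.le, hα.le])
      (fun i => by fin_cases i <;> exact isAlgebraic_one)
      (fun i => by fin_cases i <;> simp [hBalg, hαalg])
      (fun i => by
        fin_cases i
        · exact ⟨hdB, hiB1⟩
        · exact ⟨hdL, hiL1⟩)
      (by
        simp only [Fin.sum_univ_two, Matrix.cons_val_zero, Matrix.cons_val_one, div_one, Int.cast_neg,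
          Int.cast_mul]
        linear_combination hlog)
    have e : ∑ i : Fin 2, (![s * c, -m] i : ℤ) • KZ.of (![rB, rL] i) =
        (s * c) • KZ.of rB - m • KZ.of rL := by
      simp only [Fin.sum_univ_two, Matrix.cons_val_zero, Matrix.cons_val_one, neg_smul]
      abel
    rw [e] at h
    exact h
  -- assembly
  have e : M • KZ.of rI + k • KZ.of rP - m • KZ.of rL =
      s • (((q : ℤ) ^ 2) • KZ.of rI + ((p : ℤ) ^ 2) • KZ.of rP - c • KZ.of rB) +
        ((s * c) • KZ.of rB - m • KZ.of rL) := by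
    rw [hs, hk]
    module
  rw [e]
  exact KZ.relations.add_mem (KZ.relations.zsmul_mem hprim s) hL

/-- **The crux `TorsionLogs.NeronTorsionSector`, by name, from the landed primitive chain `stub_assembly`.**
[cite: KontsevichZagier2001, §1.2] -/
theorem NeronTorsionSector_of : NeronTorsionSector :=
  NeronTorsionSector_of_primitiveChain stub_assembly

end Summit.KontsevichZagierPeriods.KontsevichZagierPeriods.Cruxes.NeronTorsionSector.Translation
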